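import Summits.QuantumFields.BalabanUV.Gaps.CapTailFloors

/-!
# Gaps / CapSignsNecessary — the NECESSITY side of rows CAP ∕ tail: what [I] Theorem 2 AS PRINTED forces on the one-loop coefficients
# (cell pub-balaban-gaps, seat g1-p3 gen 3, CAP+tail «split ∕ weakening» charge; companion of `Gaps/CapTailSigns`, `Gaps/CapSignsConstRoad`,
# `Gaps/CapTailFloors`, which record SUFFICIENT currencies)

HONEST FRAMING (cell rule, page 1 of everything): bookkeeping over the β sub-cell's hypothesis carriers (`FlowStep.HBeta`, `B12Beta.OneLoopSplit`,
`B12.Construction`); NOTHING of Bałaban's is asserted beyond print; [Balaban1987RG1] Thm 2 is UNPROVED IN PRINT and enters below only as the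
HYPOTHESIS `B12.Thm2Printed C L` of necessity statements; 0 binders discharged; NOT `BetaPertH`, NOT the continuum limit, NOT Clay.
HONEST DEPENDENCY (b2b cell, verbatim): «continuum YM on T⁴ ⇐ BetaPertH ∧ nine spine estimates (0/9 proved); BetaPertH ⇐ (D1) ∧ (D4) ∧ CAP+tail;
G-an2-4 gates asym, D1 and NE2/3/4.»

THE QUESTION.  The companion files prove (0.31) FROM a uniform positive floor of the one-loop coefficients `β⁰_{k+1}` (the CAP sign list below
`k₀` + the tail's eventual floor) on either remainder road.  Which part of that input does [I] Theorem 2 AS PRINTED itself FORCE?  The printed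
statement quantifies `∃ β, β′` AFTER `g` and BEFORE `K` and asks (0.31) for EVERY lattice `K` and every `k ≤ K`; on the lattice `K = k + 1` its
lower half at index `k` reads `β·log L ≤ 1/g_k² − 1/g² = β_{k+1}(g_0, …, g_k)` along the realised history (the tree's K = 1 case is
`Beta.PrefixAbsorption.first_beta_pos_of_thm2Printed`; the every-`K` form on the Erice Markov carrier is
`Summit.QuantumFields.BalabanUV.Beta.EriceFlowEnclosureLowerDrift.lastStep_neg_of_thm2Printed`).  READING CAVEAT: this rides on the COARSE lattices `K = k+1` of the typed ∀-K statement (as `PrefixAbsorption` §4); under a «K ≥ K₀ only» reading §2 survives for the late scales and §3 for windows ending at `K ≥ K₀`.  Here, for the [I]-side history carrier and a printed one-loop split: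

§1 `runs_of_thm2Printed`, `exists_boxPoint_ge_of_thm2Printed` — for a forward-generated construction (halting outside, curried) satisfying
   `B12.Thm2Printed C L`: on every small box `]0,γ]^{k+1}` EVERY `β_{k+1}` takes a value `≥ β·log L` at a realised history, with ONE `β > 0` serving
   all `k` (general `HBeta`; [folklore] unpacking + `FlowStepRuns.rgEqH_of_inInterval`).
§2 **(N1) NECESSITY OF THE (non-strict) SIGN LIST** `beta0_nonneg_of_thm2Printed`: if the remainder `β¹_{k+1}` of a split `S` is small near the
   zero history AT EACH SCALE (`∀ k ε>0 ∃ γ>0, |β¹_{k+1}| ≤ ε on ]0,γ]^{k+1}` — implied by CONTINUITY of `β¹_{k+1}` on the CLOSED box `[0,γ]^{k+1}`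
   plus the printed vanishing at `g_k = 0` (`remainderSmallAtZero_of_continuousOn_closedBox`, no remainder bound at all), by (AF-1), by
   `CapSignsConstRoad.EverySlope`, by `RemainderResidue.EpsUniform`), then `B12.Thm2Printed C L` with `L > 1` forces `0 ≤ β⁰_{k+1}` for EVERY `k`
   (`_closedBox` ∕ `_everySlope` ∕ `_af1` ∕ `_limitForm`).  Reading for row CAP-k: certified
   numerics of `sign β⁰_{k+1}(L)` are a TWO-SIDED test — a certified NEGATIVE value at any `k` refutes Theorem 2 as printed for that `L` (on this
   reading of the construction), a certified positive list below `k₀` proves it given the tail (`CapTailSigns.thm2Printed_of_signs`).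
§3 **(N2) NECESSITY OF POSITIVE LONG-WINDOW MEANS on the every-slope road** `beta0_windowSum_lower_of_thm2Printed`: with
   `CapSignsConstRoad.EverySlope S γc` (the (D4) currency; ⟸ (AF-1), ⟸ `EpsUniform`), `B12.Thm2Printed C L` (`L > 1`) gives `c > 0` and `A` with
   `c·n − A ≤ Σ_{j∈[k,k+n)} β⁰_{j+1}` for ALL `k, n` (the realised prefixes far from the end of a run lie in a small box BY (0.31) ITSELF, where the
   remainder is below half the slope — chosen after `β`; the late scales cost `O(1)`); `_af1` = the linear road.  Corollaries: partial sums of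
   `β⁰` are unbounded (`not_thm2Printed_of_beta0_partialSums_bounded`); **the ABELIAN one-loop part alone refutes (0.31)**
   (`not_thm2Printed_of_abelian_everySlope`: `Σ_k (L⁴−1)/(4L^{4(k+1)}) ≤ 1/4`, cap3's `Beta.Certified.sum_range_abelianCoeff`; same hypotheses as
   `CapTailFloors.not_betaAFH_of_abelian_everySlope`, which refutes (AF) only); and some `β⁰_{j+1} ≥ c` in EVERY window of a fixed length
   (`beta0_syndeticPos_of_thm2Printed`).
§4 — SHARPNESS is the companion file `Gaps/CapFloorNotNecessary.lean` (kernel witnesses: a split with `β⁰_1 = 0` and NO eventual floor whose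
   canonical construction satisfies Theorem 2 as printed — so (N1) cannot be made strict and the tail's floor is not necessary —, and a split with
   the same `β⁰_1 = 0` meeting (N1), (N2), (AF-1) for which it fails: at the boundary the remainder's sign decides).
So for the (0.31) row: NECESSARY `0 ≤ β⁰_{k+1}` (all k) + positive long-window means; SUFFICIENT `0 < β⁰_{k+1}` (k < k₀) + eventual floor; in the
gap (a coefficient EXACTLY `0`, or positive coefficients accumulating at `0`) the remainder decides (companion file) — for a certified value
`β⁰_{k+1}(L) ≠ 0` the sign alone settles that scale's contribution.
All [folklore] real-sequence bookkeeping; 0 sorry; 0 new hypotheses about Bałaban's objects; imports `Gaps.CapTailFloors` (→ `CapSignsConstRoad`,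
`Beta.Assembly`, `Beta.Certified`, `FlowStepRuns`); restates nothing of them.
-/

namespace Summit.QuantumFields.BalabanUV.Gaps.CapSignsNecessary

open Literature.MathematicalPhysics.QuantumFieldTheory.Balaban1983to89
open Literature.MathematicalPhysics.QuantumFieldTheory.Balaban1983to89.FlowStep
open Literature.MathematicalPhysics.QuantumFieldTheory.Balaban1983to89.FlowStepRuns
open Literature.MathematicalPhysics.QuantumFieldTheory.Balaban1983to89.DagBinding
open Literature.MathematicalPhysics.QuantumFieldTheory.Balaban1983to89.Beta.RemainderChain
open Summit.QuantumFields.BalabanUV.Gaps.CapSignsConstRoad (EverySlope everySlope_of_af1)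

noncomputable section

variable {β : HBeta}

/-! ## §1 The realised runs of Theorem 2 as printed, with the history recursion (general `HBeta`) -/

/-- **THE RUNS OF THEOREM 2 AS PRINTED, WITH (0.20).**  Unpacking `B12.Thm2Printed C L` for a forward-generated construction that halts outside and
curries `β`: `∀ m ∃ γ₂ > 0 ∀ γ ∈ ]0,γ₂] ∃ g⋆ > 0 ∀ g ∈ ]0,g⋆] ∃ 0 < β ≤ β′` (BEFORE the lattice) `∀ K ∃ g₀`: the run stays in `]0,γ]`, ends at `g_K = g`,
solves the HISTORY recursion (`FlowStepRuns.rgEqH_of_inInterval`) and obeys (0.31) at every `k ≤ K`. [cite: Balaban1987RG1, Thm 2 (0.31) p.259 and (0.20) p.256] -/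
theorem runs_of_thm2Printed {C : B12.Construction} (hgen : ForwardGenerated C β) (hhalt : HaltsOutside C β)
    (hcur : CurriesHBeta C β) {L : ℝ} (h : B12.Thm2Printed C L) (m : ℕ) :
    ∃ γ₂ : ℝ, 0 < γ₂ ∧ ∀ γ : ℝ, 0 < γ → γ ≤ γ₂ → ∃ gstar : ℝ, 0 < gstar ∧ ∀ g : ℝ, 0 < g → g ≤ gstar →
      ∃ b β' : ℝ, 0 < b ∧ b ≤ β' ∧ ∀ K : ℕ, ∃ g0 : ℝ,
        (C ⟨K, m, g0⟩).flow.InInterval γ K ∧ (C ⟨K, m, g0⟩).flow.g K = g ∧ RGEqH K β (C ⟨K, m, g0⟩).flow.g ∧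
        ∀ k, k ≤ K →
          1 / g ^ 2 + b * (((K : ℝ) - k) * Real.log L) ≤ 1 / ((C ⟨K, m, g0⟩).flow.g k) ^ 2 ∧
          1 / ((C ⟨K, m, g0⟩).flow.g k) ^ 2 ≤ 1 / g ^ 2 + β' * (((K : ℝ) - k) * Real.log L) := by
  obtain ⟨γ₂, hγ₂, hγ⟩ := h m
  refine ⟨γ₂, hγ₂, fun γ hγ0 hγle => ?_⟩
  obtain ⟨gstar, hgstar, hg⟩ := hγ γ hγ0 hγle
  refine ⟨gstar, hgstar, fun g hg0 hgle => ?_⟩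
  obtain ⟨b, β', hb, hbβ', hK⟩ := hg g hg0 hgle
  refine ⟨b, β', hb, hbβ', fun K => ?_⟩
  obtain ⟨g0, hI, hend, hbounds⟩ := hK K
  exact ⟨g0, hI, hend, rgEqH_of_inInterval hgen hhalt hcur ⟨K, m, g0⟩ hI, hbounds⟩

/-- **REALISED WINDOW SUMS.**  Along a solution of the history recursion up to `K` ending at `g_K = g` and obeying the lower half of (0.31) with
constant `b`, every suffix window sum of the β's is at least `b·(K−k)·log L`:
`Σ_{j∈[k,K)} β_{j+1}(g_0,…,g_j) = 1/g_k² − 1/g² ≥ b(K−k) log L`. [cite: Balaban1987RG1, (0.31) p.259 and (0.20) p.256] -/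
theorem windowSum_ge_of_run {K : ℕ} {g : ℕ → ℝ} {gK b L : ℝ} (hrg : RGEqH K β g) (hend : g K = gK)
    (hlow : ∀ k, k ≤ K → 1 / gK ^ 2 + b * (((K : ℝ) - k) * Real.log L) ≤ 1 / (g k) ^ 2) {k : ℕ} (hk : k ≤ K) :
    b * (((K : ℝ) - k) * Real.log L) ≤ ∑ j ∈ Finset.Ico k K, β j (prefixOf g j) := by
  have ht := inv_sq_telescopeH hrg hk le_rfl
  have hl := hlow k hk
  rw [hend] at ht
  linarith

/-- **ON EVERY SMALL BOX, EVERY `β_{k+1}` IS `≥ β·log L` SOMEWHERE — ONE `β > 0` FOR ALL `k`.**  For a forward-generated construction (halting outside,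
curried) with `B12.Thm2Printed C L`: `∀ m ∃ γ₂ > 0 ∀ γ ∈ ]0,γ₂] ∃ β > 0` (the printed lower constant at `g = g⋆`) `∀ k ∃ v ∈ ]0,γ]^{k+1}` — the realised
history of the lattice `K = k+1` — with `β·log L ≤ β_{k+1}(v)` (positive once `L > 1`).  (`K = 1`: `PrefixAbsorption.first_beta_pos_of_thm2Printed`.)
[cite: Balaban1987RG1, Thm 2 (0.31) p.259] -/
theorem exists_boxPoint_ge_of_thm2Printed {C : B12.Construction} (hgen : ForwardGenerated C β) (hhalt : HaltsOutside C β)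
    (hcur : CurriesHBeta C β) {L : ℝ} (h : B12.Thm2Printed C L) (m : ℕ) :
    ∃ γ₂ : ℝ, 0 < γ₂ ∧ ∀ γ : ℝ, 0 < γ → γ ≤ γ₂ → ∃ b : ℝ, 0 < b ∧
      ∀ k : ℕ, ∃ v ∈ Box γ k, b * Real.log L ≤ β k v := by
  obtain ⟨γ₂, hγ₂, hγ⟩ := runs_of_thm2Printed hgen hhalt hcur h m
  refine ⟨γ₂, hγ₂, fun γ hγ0 hγle => ?_⟩
  obtain ⟨gstar, hgstar, hg⟩ := hγ γ hγ0 hγle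
  obtain ⟨b, β', hb, -, hK⟩ := hg gstar hgstar le_rfl
  refine ⟨b, hb, fun k => ?_⟩
  obtain ⟨g0, hI, hend, hrg, hbounds⟩ := hK (k + 1)
  refine ⟨prefixOf (C ⟨k + 1, m, g0⟩).flow.g k, mem_box.mpr fun i => hI i (by omega), ?_⟩
  have hw := windowSum_ge_of_run hrg hend (fun j hj => (hbounds j hj).1) (Nat.le_succ k)
  rw [Finset.sum_Ico_succ_top le_rfl, Finset.Ico_self, Finset.sum_empty, zero_add] at hw
  have e : (((k + 1 : ℕ) : ℝ) - k) * Real.log L = Real.log L := by push_cast; ring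
  rw [e] at hw
  exact hw

/-! ## §2 (N1) The non-strict SIGN LIST of the one-loop coefficients is NECESSARY -/

/-- **(N1) — [I] THEOREM 2 AS PRINTED FORCES `0 ≤ β⁰_{k+1}` FOR EVERY `k`** (forward-generated construction, halting outside, curried; `L > 1`), as soon
as the remainder of the printed one-loop split `β_{k+1} = β⁰_{k+1} + β¹_{k+1}` is small near the zero history AT EACH SCALE:
`∀ k, ∀ ε > 0, ∃ γ > 0, |β¹_{k+1}| ≤ ε on ]0,γ]^{k+1}`.  Proof: if `β⁰_{k+1} < 0`, take `ε = −β⁰_{k+1}/2` and the box of §1 inside the ε-box: there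
`β_{k+1} ≤ β⁰_{k+1}/2 < 0` everywhere, contradicting `exists_boxPoint_ge_of_thm2Printed`.  READING (row CAP-k): on this reading of the construction a
certified `β⁰_{k+1}(L) < 0` at ANY `k` REFUTES Theorem 2 as printed for that `L` — GIVEN the near-zero control `hR`, which is load-bearing (`CapFloorNotNecessary.nearZero_control_needed`). [cite: Balaban1987RG1, Thm 2 (0.31) p.259; (2.12)-(2.14) p.268] -/
theorem beta0_nonneg_of_thm2Printed {C : B12.Construction} (hgen : ForwardGenerated C β) (hhalt : HaltsOutside C β)
    (hcur : CurriesHBeta C β) (S : B12Beta.OneLoopSplit β)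
    (hR : ∀ (k : ℕ) (ε : ℝ), 0 < ε → ∃ γ : ℝ, 0 < γ ∧ ∀ p ∈ B12Beta.HistBox γ k, |S.β1 k p| ≤ ε)
    {L : ℝ} (hL : 1 < L) (h : B12.Thm2Printed C L) (k : ℕ) : 0 ≤ S.β0 k := by
  refine le_of_not_gt fun hneg => ?_
  obtain ⟨γε, hγε, hε⟩ := hR k (-(S.β0 k) / 2) (by linarith)
  obtain ⟨γ₂, hγ₂, hγ⟩ := exists_boxPoint_ge_of_thm2Printed hgen hhalt hcur h 0
  obtain ⟨b, hb, hk⟩ := hγ (min γ₂ γε) (lt_min hγ₂ hγε) (min_le_left _ _)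
  obtain ⟨v, hv, hbv⟩ := hk k
  have hvε : v ∈ B12Beta.HistBox γε k := fun i => ⟨(mem_box.mp hv i).1, (mem_box.mp hv i).2.trans (min_le_right _ _)⟩
  have h1 := (abs_le.mp (hε v hvε)).2
  have hpos : 0 < b * Real.log L := mul_pos hb (Real.log_pos hL)
  rw [S.split k v] at hbv
  linarith

/-- **(N1)'s smallness hypothesis from PRINT-SHAPED data.**  The remainder `β¹_{k+1}` VANISHES at `g_k = 0` (the field `OneLoopSplit.vanish`;
[I] p. 268: the expression (2.13) «vanishes at g_k = 0») and is CONTINUOUS ON THE CLOSED BOX `[0,γ]^{k+1}` at each scale (p. 264: the β-functions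
are «analytic functions of g_0, …, g_k defined on [0, γ]» — a reading; the tree's `BetaContH` is continuity on the box open at 0 only) ⟹ for every
`k` and `ε > 0` some `γ' > 0` has `|β¹_{k+1}| ≤ ε` on `]0,γ']^{k+1}` (uniform continuity on the compact box, comparing `p` with `p|_{g_k := 0}`).
No k-uniformity is asked or obtained. [cite: Balaban1987RG1, §1 p.264 and (2.13) p.268] -/
theorem remainderSmallAtZero_of_continuousOn_closedBox (S : B12Beta.OneLoopSplit β) {γ : ℝ} (hγ : 0 < γ)
    (hcont : ∀ k, ContinuousOn (S.β1 k) (Set.pi Set.univ fun _ : Fin (k + 1) => Set.Icc 0 γ)) :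
    ∀ (k : ℕ) (ε : ℝ), 0 < ε → ∃ γ' : ℝ, 0 < γ' ∧ ∀ p ∈ B12Beta.HistBox γ' k, |S.β1 k p| ≤ ε := by
  intro k ε hε
  have hK : IsCompact (Set.pi Set.univ fun _ : Fin (k + 1) => Set.Icc (0 : ℝ) γ) :=
    isCompact_univ_pi fun _ => isCompact_Icc
  have hU := hK.uniformContinuousOn_of_continuous (hcont k)
  obtain ⟨δ, hδ, hδε⟩ := Metric.uniformContinuousOn_iff.mp hU ε hε
  refine ⟨min γ (δ / 2), lt_min hγ (by positivity), fun p hp => ?_⟩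
  have hpK : p ∈ Set.pi Set.univ fun _ : Fin (k + 1) => Set.Icc (0 : ℝ) γ :=
    fun i _ => ⟨(hp i).1.le, (hp i).2.trans (min_le_left _ _)⟩
  set q : Fin (k + 1) → ℝ := Function.update p (Fin.last k) 0 with hq
  have hqK : q ∈ Set.pi Set.univ fun _ : Fin (k + 1) => Set.Icc (0 : ℝ) γ := by
    intro i _
    by_cases hi : i = Fin.last k
    · subst hi; simp [hq, hγ.le]
    · rw [hq, Function.update_of_ne hi]; exact hpK i (Set.mem_univ i)
  have hq0 : S.β1 k q = 0 := S.vanish k q (by simp [hq])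
  have hdist : dist p q < δ := by
    have hle : dist p q ≤ δ / 2 := by
      refine (dist_pi_le_iff (by positivity)).mpr fun i => ?_
      by_cases hi : i = Fin.last k
      · subst hi
        rw [hq, Function.update_self, Real.dist_eq, sub_zero, abs_of_pos (hp _).1]
        exact (hp _).2.trans (min_le_right _ _)
      · rw [hq, Function.update_of_ne hi, dist_self]; positivity
    linarith
  have h := hδε p hpK q hqK hdist
  rw [Real.dist_eq, hq0, sub_zero] at h
  exact h.le

/-- (N1) from the print-shaped data: forward generation (halting, curried), a split whose remainder is continuous on the CLOSED boxes `[0,γ]^{k+1}`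
(and vanishes at `g_k = 0`, as every `OneLoopSplit` does), `B12.Thm2Printed C L` with `L > 1` ⟹ `∀ k, 0 ≤ β⁰_{k+1}` — the weakest road to the
necessity of the sign list: NO remainder BOUND ((AF-1) ∕ (D4)) is used, only continuity up to the face `g_k = 0`.
[cite: Balaban1987RG1, Thm 2 (0.31) p.259 and §1 p.264] -/
theorem beta0_nonneg_of_thm2Printed_closedBox {C : B12.Construction} (hgen : ForwardGenerated C β) (hhalt : HaltsOutside C β)
    (hcur : CurriesHBeta C β) (S : B12Beta.OneLoopSplit β) {γ : ℝ} (hγ : 0 < γ)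
    (hcont : ∀ k, ContinuousOn (S.β1 k) (Set.pi Set.univ fun _ : Fin (k + 1) => Set.Icc 0 γ))
    {L : ℝ} (hL : 1 < L) (h : B12.Thm2Printed C L) : ∀ k, 0 ≤ S.β0 k :=
  beta0_nonneg_of_thm2Printed hgen hhalt hcur S (remainderSmallAtZero_of_continuousOn_closedBox S hγ hcont) hL h

/-- (N1) on the every-slope ∕ constant-remainder road: `CapSignsConstRoad.EverySlope S γc` (remainder below any `s > 0` on some box, all `k`) supplies
the scale-wise smallness, so `B12.Thm2Printed C L` ⟹ `∀ k, 0 ≤ β⁰_{k+1}`. [cite: Balaban1987RG1, Thm 2 (0.31) p.259] -/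
theorem beta0_nonneg_of_thm2Printed_everySlope {C : B12.Construction} (hgen : ForwardGenerated C β) (hhalt : HaltsOutside C β)
    (hcur : CurriesHBeta C β) (S : B12Beta.OneLoopSplit β) {γc : ℝ} (hrem : EverySlope S γc)
    {L : ℝ} (hL : 1 < L) (h : B12.Thm2Printed C L) : ∀ k, 0 ≤ S.β0 k :=
  beta0_nonneg_of_thm2Printed hgen hhalt hcur S
    (fun k ε hε => by
      obtain ⟨γ, hγ, -, hRC⟩ := hrem ε hε
      exact ⟨γ, hγ, fun p hp => hRC k p hp⟩) hL h

/-- (N1) on the linear (AF-1) road: `|β¹_{k+1}(p)| ≤ C_r·p_k` on `]0,γ₀]`-histories (`C_r ≥ 0`, `γ₀ > 0`; the `Beta.Assembly.LimitForm.af1` field) ⟹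
(`B12.Thm2Printed C L`, `L > 1` ⟹ `∀ k, 0 ≤ β⁰_{k+1}`).  Compare the SUFFICIENT direction `CapTailSigns.thm2Printed_of_signs` (strict signs below
`k₀` + the tail). [cite: Balaban1987RG1, Thm 2 (0.31) p.259 and §1 p.264] -/
theorem beta0_nonneg_of_thm2Printed_af1 {C : B12.Construction} (hgen : ForwardGenerated C β) (hhalt : HaltsOutside C β)
    (hcur : CurriesHBeta C β) (S : B12Beta.OneLoopSplit β) {Cr γ₀ : ℝ} (hγ₀ : 0 < γ₀) (hCr : 0 ≤ Cr)
    (hAF1 : ∀ k (p : Fin (k + 1) → ℝ), p ∈ B12Beta.HistBox γ₀ k → |S.β1 k p| ≤ Cr * p (Fin.last k))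
    {L : ℝ} (hL : 1 < L) (h : B12.Thm2Printed C L) : ∀ k, 0 ≤ S.β0 k :=
  beta0_nonneg_of_thm2Printed_everySlope hgen hhalt hcur S (everySlope_of_af1 S hγ₀ hCr hAF1) hL h

/-- (N1) for the β sub-cell's limit-form carrier `D : Beta.Assembly.LimitForm β` (its (AF-1) field): `B12.Thm2Printed C L`, `L > 1` ⟹
`∀ k, 0 ≤ β⁰_{k+1}`; together with `CapTailSigns.thm2Printed_of_signs` the CAP of the (0.31) row on this road is bracketed between the
non-strict sign list (necessary) and the strict sign list below `k₀` (sufficient). [cite: Balaban1987RG1, Thm 2 (0.31) p.259] -/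
theorem beta0_nonneg_of_thm2Printed_limitForm (D : Beta.Assembly.LimitForm β) {C : B12.Construction} (hgen : ForwardGenerated C β)
    (hhalt : HaltsOutside C β) (hcur : CurriesHBeta C β) {L : ℝ} (hL : 1 < L) (h : B12.Thm2Printed C L) : ∀ k, 0 ≤ D.S.β0 k :=
  beta0_nonneg_of_thm2Printed_af1 hgen hhalt hcur D.S D.γ₀_pos D.Cr_nonneg D.af1 hL h

/-! ## §3 (N2) Positive LONG-WINDOW MEANS of the one-loop coefficients are NECESSARY (every-slope road, hence the (AF-1) road) -/

/-- Plumbing for (N2).  Along a solution of the history recursion in `]0,γ]` up to `K`, ending at `g_K > 0` and obeying the lower half of (0.31)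
with slope `c > 0` (`1/g_K² + c(K−j) ≤ 1/g_j²`), with the remainder of the split bounded by `R` on `]0,γ]`-histories and by `s` on the SMALL
box `]0,γₛ]` (`1 ≤ c·N₀·γₛ²`): every realised prefix at distance `≥ N₀` from the end lies in the small box (its couplings are
`≤ (c N₀)^{-1/2} ≤ γₛ` BY (0.31) ITSELF), so `(c − s)(K−k) − R·N₀ ≤ Σ_{j∈[k,K)} β⁰_{j+1}`. [folklore] -/
theorem beta0_windowSum_ge_of_run (S : B12Beta.OneLoopSplit β) {K k N₀ : ℕ} {g : ℕ → ℝ} {gK c γ γs s R : ℝ}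
    (hc : 0 < c) (hrg : RGEqH K β g) (hend : g K = gK) (hgK : 0 < gK) (hI : ∀ j, j ≤ K → 0 < g j ∧ g j ≤ γ)
    (hR : RemainderConst S γ R) (hs : RemainderConst S γs s) (hγs : 0 < γs) (hN₀ : 1 ≤ c * N₀ * γs ^ 2)
    (hlow : ∀ j, j ≤ K → 1 / gK ^ 2 + c * ((K : ℝ) - j) ≤ 1 / (g j) ^ 2) (hk : k ≤ K) :
    (c - s) * ((K : ℝ) - k) - R * N₀ ≤ ∑ j ∈ Finset.Ico k K, S.β0 j := by
  have hgK2 : 0 < 1 / gK ^ 2 := by positivity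
  -- the full realised window sum of β
  have ht := inv_sq_telescopeH hrg hk le_rfl
  rw [hend] at ht
  have hwin : c * ((K : ℝ) - k) ≤ ∑ j ∈ Finset.Ico k K, β j (prefixOf g j) := by linarith [hlow k hk]
  -- split the window at M = max k (K − N₀)
  set M : ℕ := max k (K - N₀) with hM
  have hkM : k ≤ M := le_max_left _ _
  have hMK : M ≤ K := max_le hk (Nat.sub_le K N₀)
  -- far from the end: the whole prefix lies in the small box, remainder ≤ s
  have hfar : ∀ j ∈ Finset.Ico k M, β j (prefixOf g j) ≤ S.β0 j + s := by
    intro j hj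
    obtain ⟨hkj, hjM⟩ := Finset.mem_Ico.mp hj
    have hjK' : j < K - N₀ := by
      rcases lt_max_iff.mp (hM ▸ hjM) with h | h
      · exact absurd hkj (not_le.mpr h)
      · exact h
    have hp : prefixOf g j ∈ B12Beta.HistBox γs j := by
      intro i
      have hiK : (i : ℕ) ≤ K := by omega
      have hgi := (hI i hiK).1
      refine ⟨by simpa [prefixOf_apply] using hgi, ?_⟩
      have hdist : (N₀ : ℝ) ≤ (K : ℝ) - (i : ℕ) := by
        have h1 : (i : ℕ) + N₀ < K := by omega
        have h2 : (((i : ℕ) + N₀ : ℕ) : ℝ) ≤ K := by exact_mod_cast h1.le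
        push_cast at h2
        linarith
      have h1 : c * N₀ ≤ 1 / (g i) ^ 2 := by
        have := hlow i hiK
        nlinarith [mul_le_mul_of_nonneg_left hdist hc.le]
      have hg2 : 0 < (g i) ^ 2 := by positivity
      have h2 : c * N₀ * (g i) ^ 2 ≤ 1 := by rwa [← le_div_iff₀ hg2]
      have h3 : (g i) ^ 2 ≤ γs ^ 2 := by nlinarith [hN₀, h2, hg2.le, sq_nonneg γs]
      have h4 : g i ≤ γs := (pow_le_pow_iff_left₀ hgi.le hγs.le two_ne_zero).mp h3
      simpa [prefixOf_apply] using h4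
    have h1 := (abs_le.mp (hs j _ hp)).2
    rw [S.split j]
    linarith
  -- near the end: remainder ≤ R on the run's box
  have hnear : ∀ j ∈ Finset.Ico M K, β j (prefixOf g j) ≤ S.β0 j + R := by
    intro j hj
    have hjK : j ≤ K := (Finset.mem_Ico.mp hj).2.le
    have hp : prefixOf g j ∈ B12Beta.HistBox γ j := fun i => hI i (by omega)
    have h1 := (abs_le.mp (hR j _ hp)).2
    rw [S.split j]
    linarith
  have hs0 : 0 ≤ s := by
    have := hs 0 (fun _ => γs) (fun _ => ⟨hγs, le_rfl⟩)
    exact (abs_nonneg _).trans this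
  have hR0 : 0 ≤ R := by
    have hγ0 : 0 < γ := (hI 0 (Nat.zero_le K)).1.trans_le (hI 0 (Nat.zero_le K)).2
    have := hR 0 (fun _ => γ) (fun _ => ⟨hγ0, le_rfl⟩)
    exact (abs_nonneg _).trans this
  have hs1 := Finset.sum_le_sum hfar
  have hs2 := Finset.sum_le_sum hnear
  rw [Finset.sum_add_distrib, Finset.sum_const, Nat.card_Ico, nsmul_eq_mul] at hs1 hs2
  have hc1 : ((M - k : ℕ) : ℝ) ≤ (K : ℝ) - k := by
    rw [Nat.cast_sub hkM]
    have : (M : ℝ) ≤ K := by exact_mod_cast hMK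
    linarith
  have hc2 : ((K - M : ℕ) : ℝ) ≤ N₀ := by exact_mod_cast (show K - M ≤ N₀ by omega)
  have hsplitβ := Finset.sum_Ico_consecutive (fun j => β j (prefixOf g j)) hkM hMK
  have hsplit0 := Finset.sum_Ico_consecutive S.β0 hkM hMK
  nlinarith [hs1, hs2, hwin, hsplitβ, hsplit0, mul_le_mul_of_nonneg_right hc1 hs0, mul_le_mul_of_nonneg_right hc2 hR0]

/-- **(N2) — [I] THEOREM 2 AS PRINTED FORCES POSITIVE LONG-WINDOW MEANS OF THE ONE-LOOP COEFFICIENTS**, on the every-slope road.  For a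
forward-generated construction (halting outside, curried) from a split with `CapSignsConstRoad.EverySlope S γc` (remainder below any `s > 0` on
some box, all `k` — the (D4) currency; supplied by (AF-1) and by `RemainderResidue.EpsUniform`), `B12.Thm2Printed C L` with `L > 1` yields
constants `c > 0`, `A` with `c·n − A ≤ Σ_{j∈[k,k+n)} β⁰_{j+1}` for ALL `k, n`.  Mechanism: on the lattice `K = k + n` the realised window sum of
`β` is `≥ β·n·log L` (§1); by the lower half of (0.31) itself the realised prefixes at distance `≥ N₀` from the end lie in the box where the
remainder is `≤ β log L / 2` (chosen AFTER `β` — the every-slope currency allows it), and the `< N₀` late scales cost `O(1)`.  Constants: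
`c = (β log L)/2`, `A = ⌈1/(β log L · γₛ²)⌉`. [cite: Balaban1987RG1, Thm 2 (0.31) p.259; Thm 3 p.264] -/
theorem beta0_windowSum_lower_of_thm2Printed {C : B12.Construction} (hgen : ForwardGenerated C β) (hhalt : HaltsOutside C β)
    (hcur : CurriesHBeta C β) (S : B12Beta.OneLoopSplit β) {γc : ℝ} (hrem : EverySlope S γc)
    {L : ℝ} (hL : 1 < L) (h : B12.Thm2Printed C L) :
    ∃ c : ℝ, 0 < c ∧ ∃ A : ℝ, ∀ k n : ℕ, c * n - A ≤ ∑ j ∈ Finset.Ico k (k + n), S.β0 j := by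
  obtain ⟨γ₁, hγ₁, -, hR1⟩ := hrem 1 one_pos
  obtain ⟨γ₂, hγ₂, hγ⟩ := runs_of_thm2Printed hgen hhalt hcur h 0
  obtain ⟨gstar, hgstar, hg⟩ := hγ (min γ₁ γ₂) (lt_min hγ₁ hγ₂) (min_le_right _ _)
  obtain ⟨b, β', hb, -, hK⟩ := hg gstar hgstar le_rfl
  have hlog : 0 < Real.log L := Real.log_pos hL
  set c : ℝ := b * Real.log L with hc_def
  have hc : 0 < c := mul_pos hb hlog
  obtain ⟨γs, hγs, -, hs⟩ := hrem (c / 2) (by positivity)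
  set N₀ : ℕ := ⌈1 / (c * γs ^ 2)⌉₊ with hN₀_def
  have hN₀ : 1 ≤ c * N₀ * γs ^ 2 := by
    have h1 : 1 / (c * γs ^ 2) ≤ N₀ := Nat.le_ceil _
    rw [div_le_iff₀ (by positivity)] at h1
    linarith
  have hR : RemainderConst S (min γ₁ γ₂) 1 := fun k p hp => hR1 k p fun i => ⟨(hp i).1, (hp i).2.trans (min_le_left _ _)⟩
  refine ⟨c / 2, by positivity, 1 * N₀, fun k n => ?_⟩
  obtain ⟨g0, hI, hend, hrg, hbounds⟩ := hK (k + n)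
  have hw := beta0_windowSum_ge_of_run S hc hrg hend hgstar hI hR hs hγs hN₀
    (fun j hj => by have := (hbounds j hj).1; rw [hc_def]; linarith) (Nat.le_add_right k n)
  have e : (((k + n : ℕ) : ℝ) - k) = n := by push_cast; ring
  rw [e] at hw
  linarith

/-- (N2) on the linear (AF-1) road `|β¹_{k+1}(p)| ≤ C_r·p_k` on `]0,γ₀]`-histories (`C_r ≥ 0`, `γ₀ > 0`; via `CapSignsConstRoad.everySlope_of_af1`).
[cite: Balaban1987RG1, Thm 2 (0.31) p.259 and §1 p.264] -/
theorem beta0_windowSum_lower_of_thm2Printed_af1 {C : B12.Construction} (hgen : ForwardGenerated C β) (hhalt : HaltsOutside C β)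
    (hcur : CurriesHBeta C β) (S : B12Beta.OneLoopSplit β) {Cr γ₀ : ℝ} (hγ₀ : 0 < γ₀) (hCr : 0 ≤ Cr)
    (hAF1 : ∀ k (p : Fin (k + 1) → ℝ), p ∈ B12Beta.HistBox γ₀ k → |S.β1 k p| ≤ Cr * p (Fin.last k))
    {L : ℝ} (hL : 1 < L) (h : B12.Thm2Printed C L) :
    ∃ c : ℝ, 0 < c ∧ ∃ A : ℝ, ∀ k n : ℕ, c * n - A ≤ ∑ j ∈ Finset.Ico k (k + n), S.β0 j :=
  beta0_windowSum_lower_of_thm2Printed hgen hhalt hcur S (everySlope_of_af1 S hγ₀ hCr hAF1) hL h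

/-- From window sums `c·n − A ≤ Σ_{[k,k+n)} b_j` (`c > 0`): the partial sums of `b` are UNBOUNDED above. [folklore] -/
theorem not_partialSums_bounded_of_windowSum_lower {b : ℕ → ℝ} {c A : ℝ} (hc : 0 < c)
    (hw : ∀ k n : ℕ, c * n - A ≤ ∑ j ∈ Finset.Ico k (k + n), b j) (B : ℝ) :
    ¬ ∀ n : ℕ, ∑ j ∈ Finset.range n, b j ≤ B := by
  intro hB
  obtain ⟨n, hn⟩ := exists_nat_gt ((A + B) / c)
  have h1 := hw 0 n
  rw [zero_add, ← Finset.range_eq_Ico] at h1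
  have h2 := hB n
  rw [div_lt_iff₀ hc] at hn
  linarith

/-- From window sums `c·n − A ≤ Σ_{[k,k+n)} b_j` (`c > 0`): `b` is `≥ c/2` SYNDETICALLY — in every window of a fixed length `n₀` some term is `≥ c/2`.
[folklore] -/
theorem syndetic_of_windowSum_lower {b : ℕ → ℝ} {c A : ℝ} (hc : 0 < c)
    (hw : ∀ k n : ℕ, c * n - A ≤ ∑ j ∈ Finset.Ico k (k + n), b j) :
    ∃ n₀ : ℕ, 0 < n₀ ∧ ∀ k : ℕ, ∃ j ∈ Finset.Ico k (k + n₀), c / 2 ≤ b j := by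
  obtain ⟨n₀, hn₀⟩ := exists_nat_gt (max 1 (2 * A / c))
  have hn₀1 : (1 : ℝ) < n₀ := lt_of_le_of_lt (le_max_left _ _) hn₀
  have hn₀A : 2 * A / c < n₀ := lt_of_le_of_lt (le_max_right _ _) hn₀
  have hn₀pos : 0 < n₀ := by exact_mod_cast (zero_lt_one.trans hn₀1)
  refine ⟨n₀, hn₀pos, fun k => ?_⟩
  have hne : (Finset.Ico k (k + n₀)).Nonempty := Finset.nonempty_Ico.mpr (by omega)
  refine Finset.exists_le_of_sum_le hne ?_
  rw [Finset.sum_const, Nat.card_Ico, nsmul_eq_mul, show k + n₀ - k = n₀ by omega]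
  have h1 := hw k n₀
  rw [div_lt_iff₀ hc] at hn₀A
  linarith

/-- **THE PARTIAL SUMS OF β⁰ MUST BE UNBOUNDED**: on the every-slope road, a split whose one-loop coefficients have BOUNDED partial sums
(`Σ_{j<n} β⁰_{j+1} ≤ B` for all `n` — e.g. a summable sequence) admits NO forward-generated construction (halting, curried) satisfying
[I] Theorem 2 as printed, for any `L > 1`. [cite: Balaban1987RG1, Thm 2 (0.31) p.259] -/
theorem not_thm2Printed_of_beta0_partialSums_bounded {C : B12.Construction} (hgen : ForwardGenerated C β) (hhalt : HaltsOutside C β)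
    (hcur : CurriesHBeta C β) (S : B12Beta.OneLoopSplit β) {γc : ℝ} (hrem : EverySlope S γc)
    {B : ℝ} (hB : ∀ n : ℕ, ∑ j ∈ Finset.range n, S.β0 j ≤ B) {L : ℝ} (hL : 1 < L) : ¬ B12.Thm2Printed C L := by
  intro h
  obtain ⟨c, hc, A, hw⟩ := beta0_windowSum_lower_of_thm2Printed hgen hhalt hcur S hrem hL h
  exact not_partialSums_bounded_of_windowSum_lower hc hw B hB

/-- **THE ABELIAN ONE-LOOP PART ALONE REFUTES (0.31).**  A split whose one-loop coefficients are cap3's ABELIAN closed form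
`β⁰_{k+1} = (L_a⁴−1)/(4L_a^{4(k+1)})` (`Beta.Certified.abelianCoeff L_a k`, `L_a ≠ 0`; partial sums `(1 − L_a^{−4n})/4 ≤ 1/4`,
`Beta.Certified.sum_range_abelianCoeff`) with ANY every-slope remainder (in particular any linear one) admits NO forward-generated construction
satisfying [I] Theorem 2 as printed (any `L > 1`) — although every sign is positive (`abelianCoeff_pos`).  Same hypotheses as
`CapTailFloors.not_betaAFH_of_abelian_everySlope` (which refutes the discrete AF hypothesis `BetaAFH`); here (0.31) itself is refuted for every
construction: the non-abelian (vertex) part must supply not just a floor but already the UNBOUNDED GROWTH of `Σβ⁰`.  Arithmetic on cap3's closed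
form; no claim that it is Bałaban's β⁰. [cite: Balaban1987RG1, Thm 2 (0.31) p.259] -/
theorem not_thm2Printed_of_abelian_everySlope {C : B12.Construction} (hgen : ForwardGenerated C β) (hhalt : HaltsOutside C β)
    (hcur : CurriesHBeta C β) (S : B12Beta.OneLoopSplit β) {La : ℕ} (hLa : La ≠ 0)
    (hS : ∀ k, S.β0 k = ((Beta.Certified.abelianCoeff La k : ℚ) : ℝ)) {γc : ℝ} (hrem : EverySlope S γc)
    {L : ℝ} (hL : 1 < L) : ¬ B12.Thm2Printed C L := by
  refine not_thm2Printed_of_beta0_partialSums_bounded hgen hhalt hcur S hrem (B := 1 / 4) (fun n => ?_) hL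
  have hq : ∑ j ∈ Finset.range n, S.β0 j = ((∑ j ∈ Finset.range n, Beta.Certified.abelianCoeff La j : ℚ) : ℝ) := by
    rw [Rat.cast_sum]; exact Finset.sum_congr rfl fun j _ => hS j
  rw [hq, Beta.Certified.sum_range_abelianCoeff hLa n]
  push_cast
  have : 0 ≤ 1 / (La : ℝ) ^ (4 * n) := by positivity
  linarith

/-- **SYNDETIC POSITIVITY**: on the every-slope road, [I] Theorem 2 as printed (`L > 1`) gives `c > 0` and a window length `n₀ > 0` such that in
EVERY window `[k, k+n₀)` of scales some one-loop coefficient is `≥ c` — the tail cannot stay below `c` for `n₀` consecutive scales.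
[cite: Balaban1987RG1, Thm 2 (0.31) p.259] -/
theorem beta0_syndeticPos_of_thm2Printed {C : B12.Construction} (hgen : ForwardGenerated C β) (hhalt : HaltsOutside C β)
    (hcur : CurriesHBeta C β) (S : B12Beta.OneLoopSplit β) {γc : ℝ} (hrem : EverySlope S γc)
    {L : ℝ} (hL : 1 < L) (h : B12.Thm2Printed C L) :
    ∃ c : ℝ, 0 < c ∧ ∃ n₀ : ℕ, 0 < n₀ ∧ ∀ k : ℕ, ∃ j ∈ Finset.Ico k (k + n₀), c ≤ S.β0 j := by
  obtain ⟨c, hc, A, hw⟩ := beta0_windowSum_lower_of_thm2Printed hgen hhalt hcur S hrem hL h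
  obtain ⟨n₀, hn₀, hs⟩ := syndetic_of_windowSum_lower hc hw
  exact ⟨c / 2, by positivity, n₀, hn₀, hs⟩

end

end Summit.QuantumFields.BalabanUV.Gaps.CapSignsNecessary
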